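import Summits.AtomisticToContinuum.BoseEinsteinCondensation.Theorems.BECInfDivCoherenceLevyNegativeMomentRieszAssembly

/-!
# Crux `LevyNegativeMoment` (stmt-AtomisticToContinuum-9115), line `registered`:
# the registered stub `stub_rieszSum` (L-free grid Riesz sum bound)

`∃ A ≥ 0, ∀ m (j : (ℤ/m)³), |Σ_{q ≢ 0} cos(2π q·j/m)/‖q̄‖| ≤ A·m²/(1 + ‖j̄‖²)` with `q̄_k = min(q_k, m - q_k)` —
the analytic heart of the grid Riesz kernel bound `RieszKernelBound` of the birth skeleton of the crux
(`Cruxes/LevyNegativeMoment/Lines/birth.lean`), from which `rieszKernelBound_of` recovers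
`|K(j)| ≤ (A/2π)·(L/m)/(1 + ‖j̄‖²)` for the kernel `K(j) = Σ_{q≢0} cos(2π q·j/m)/m³/|k_q|`.

Proof (parts A–G, files `BECInfDivCoherenceLevyNegativeMomentRiesz*.lean`): the filtered sum equals the full sum
(the `q = 0` term is `1/√0 = 0`); if `m ≥ 8` and some coordinate of `j` has folded size `J ≥ 1` (take the largest),
the main bound `140·m²/J²` of part G applies and `1 + ‖j̄‖² ≤ 4J²`; otherwise (`j̄ = 0` or `m ≤ 7`) the trivial
bound `18 m²` of part F applies and `1 + ‖j̄‖² ≤ 28`.  Constant: `A = 560`.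
-/

namespace Summit.AtomisticToContinuum.BoseEinsteinCondensation.Cruxes.LevyNegativeMoment.Birth

open scoped BigOperators
open Finset Riesz

/-- **The L-free grid Riesz sum bound** (registered stub `stub_rieszSum` of line `registered`, crux
`LevyNegativeMoment`): there is an absolute `A ≥ 0` (here `A = 560`) with
`|Σ_{q ≢ 0} cos(2π q·j/m)/‖q̄‖| ≤ A·m²/(1 + Σ_k j̄_k²)` for all `m` and all `j : Fin 3 → Fin m`. [folklore] -/
theorem stub_rieszSum : ∃ A : ℝ, 0 ≤ A ∧ ∀ (m : ℕ) (j : Fin 3 → Fin m), |∑ q : Fin 3 → Fin m with (∃ k, (q k : ℕ) ≠ 0), Real.cos (2 * Real.pi * (∑ k, ((q k : ℕ) : ℝ) * ((j k : ℕ) : ℝ)) / m) / Real.sqrt (∑ k, ((min (q k : ℕ) (m - (q k : ℕ)) : ℕ) : ℝ) ^ 2)| ≤ A * (m : ℝ) ^ 2 / (1 + ∑ k, ((min (j k : ℕ) (m - (j k : ℕ)) : ℕ) : ℝ) ^ 2) := by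
  refine ⟨560, by norm_num, fun m j => ?_⟩
  -- the filtered sum is the full sum: the `q = 0` term vanishes (`1/√0 = 0`)
  rw [sum_filter_of_ne (fun q _ hne => ?_)]
  swap
  · by_contra hall
    simp only [not_exists, ne_eq, not_not] at hall
    apply hne
    have h0 : ∑ k, ((min (q k : ℕ) (m - (q k : ℕ)) : ℕ) : ℝ) ^ 2 = 0 := by
      refine sum_eq_zero fun k _ => ?_
      rw [hall k]; simp
    rw [h0, Real.sqrt_zero, div_zero]
  -- the largest folded coordinate
  obtain ⟨k₀, -, hk₀⟩ := exists_max_image (univ : Finset (Fin 3))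
    (fun k => min (j k : ℕ) (m - (j k : ℕ))) univ_nonempty
  set J : ℕ := min (j k₀ : ℕ) (m - (j k₀ : ℕ)) with hJdef
  set W : ℝ := 1 + ∑ k, ((min (j k : ℕ) (m - (j k : ℕ)) : ℕ) : ℝ) ^ 2 with hW
  have hWpos : 0 < W := by rw [hW]; positivity
  have hbar_le : ∀ k, min (j k : ℕ) (m - (j k : ℕ)) ≤ J := fun k => hk₀ k (mem_univ _)
  have hsumsq : ∑ k, ((min (j k : ℕ) (m - (j k : ℕ)) : ℕ) : ℝ) ^ 2 ≤ 3 * (J : ℝ) ^ 2 := by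
    calc ∑ k, ((min (j k : ℕ) (m - (j k : ℕ)) : ℕ) : ℝ) ^ 2 ≤ ∑ _k : Fin 3, (J : ℝ) ^ 2 := by
          refine sum_le_sum fun k _ => ?_
          have : ((min (j k : ℕ) (m - (j k : ℕ)) : ℕ) : ℝ) ≤ J := by exact_mod_cast hbar_le k
          exact pow_le_pow_left₀ (by positivity) this 2
      _ = 3 * (J : ℝ) ^ 2 := by rw [sum_const, card_univ, Fintype.card_fin, nsmul_eq_mul]; norm_num
  by_cases hmain : 0 < J ∧ 8 ≤ m
  · -- main case
    obtain ⟨hJ, hm⟩ := hmain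
    have h := Riesz.abs_rieszSum_le_main hm j k₀ hJ
    rw [← hJdef] at h
    refine h.trans ?_
    have hJ1 : (1 : ℝ) ≤ J := by exact_mod_cast hJ
    have hW4 : W ≤ 4 * (J : ℝ) ^ 2 := by rw [hW]; nlinarith
    rw [div_pow]
    rw [show (140 : ℝ) * ((m : ℝ) ^ 2 / (J : ℝ) ^ 2) = 140 * (m : ℝ) ^ 2 / (J : ℝ) ^ 2 by ring]
    rw [div_le_div_iff₀ (by positivity) hWpos]
    have : 0 ≤ (m : ℝ) ^ 2 := by positivity
    nlinarith
  · -- trivial case: J = 0 or m ≤ 7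
    have htriv := (Riesz.abs_cosSum_le_sum_inv m
      (fun q => 2 * Real.pi * (∑ k, ((q k : ℕ) : ℝ) * ((j k : ℕ) : ℝ)) / m)
      (fun q => Real.sqrt (∑ k, ((min (q k : ℕ) (m - (q k : ℕ)) : ℕ) : ℝ) ^ 2))
      (fun q => Real.sqrt_nonneg _)).trans (Riesz.sum_inv_bar_le m)
    refine htriv.trans ?_
    have hW28 : W ≤ 28 := by
      rcases not_and_or.mp hmain with hJ0 | hm8
      · have hJ0' : J = 0 := by omega
        have : ∑ k, ((min (j k : ℕ) (m - (j k : ℕ)) : ℕ) : ℝ) ^ 2 = 0 := by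
          refine sum_eq_zero fun k _ => ?_
          have := hbar_le k
          rw [hJ0'] at this
          have : min (j k : ℕ) (m - (j k : ℕ)) = 0 := Nat.le_zero.mp this
          rw [this]; simp
        rw [hW, this]; norm_num
      · have hJ3 : J ≤ 3 := by omega
        have : (J : ℝ) ≤ 3 := by exact_mod_cast hJ3
        rw [hW]
        nlinarith
    rw [le_div_iff₀ hWpos]
    have : 0 ≤ (m : ℝ) ^ 2 := by positivity
    nlinarith

end Summit.AtomisticToContinuum.BoseEinsteinCondensation.Cruxes.LevyNegativeMoment.Birth
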